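import Literature.AlgebraicGeometry.AbelianSchemes.AbelianSchemeOverGenericFibreExtension
import Literature.AlgebraicGeometry.AbelianSchemes.AbelianSchemeOverIsogenyFinite
import Literature.AlgebraicGeometry.AbelianSchemes.AbelianSchemeOverMulNUnramified
import Literature.AlgebraicGeometry.AbelianSchemes.AbelianSchemeOverFibreDim
import Literature.AlgebraicGeometry.AbelianSchemes.AbelianSchemeRelDimOfConnected
import Literature.AlgebraicGeometry.AbelianSchemes.AbelianSchemeFibreHom
import Literature.AlgebraicGeometry.Motives.AbelianVarietySimpleOfIsogenyAnyField
import Literature.AlgebraicGeometry.Motives.AbelianVarietyTorsion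
import Literature.NumberTheory.DiophantineGeometry.AVKernelHopf
import HarnessLib

/-!
# A homomorphism of abelian schemes over a Dedekind domain whose GENERIC fibre is an isogeny is an isogeny on EVERY fibre;
# hence it is finite locally free and its kernel is a finite flat group scheme ([BoschLutkebohmertRaynaud1990] §7.3 Prop. 6;
# [GortzWedhorn2023] Def. 27.176, Cor. 27.177 (1); [MumfordAV1970] §19 Remark p. 169)

Topic `Literature/AlgebraicGeometry/AbelianSchemes`, namespace `Literature.AlgebraicGeometry.AbelianSchemes.AbelianSchemeOver`.  THEOREMS ONLY (no
definition, no named fact, no instance, no notation, no `sorry`).  Cell `pub/hodgecm-mathlib` (D-0151 ∕ D-0183 floor 0), P6 «MOD», door P″, DICT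
organ **(o-c2f)** of the P6c desk (F0P6c-plan (g0), 2026-09-01): the input of the sockets (c2) `red_quotΩ` ∕ `red_translΩ` of
`Cruxes/HLiu418/Lines/F0_P6c_IsogenyDictionary.lean` (an isogeny of the generic fibres of two abelian schemes over the DVR `𝒪_L` has finite flat kernel
whose special fibre is the kernel of the special-fibre isogeny) and of HEART (c3b).  Generic capital `--supports stmt-HodgeConjecture-24832`.  HONEST
LABEL: HC_CM is proved only modulo the cell's 2 remaining named inputs (hLiu418 24832, h413 24833) until rung 0 closes; this file pays no letter.

THE MATHEMATICS.  `R` a Dedekind domain with field of fractions `K` (case of record: a discrete valuation ring), `A, B` abelian schemes over `Spec R`,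
`φ : A → B` a homomorphism whose generic fibre `φ_K : A_K → B_K` is an isogeny.  (1) QUASI-INVERSE: there is `g_K : B_K → A_K` with
`φ_K g_K = [n]`, `g_K φ_K = [n]`, `n ≥ 1` ([MumfordAV1970] §19 Remark p. 169, [GortzWedhorn2023] Prop. 27.190; in the tree for EVERY characteristic:
★ `AbelianVariety.IsIsogeny.exists_nsmul_inverse_holds`, through Deligne's «`Ker f` is killed by its order»).  (2) EXTENSION: by the Néron mapping
property of abelian schemes over a Dedekind base ([BoschLutkebohmertRaynaud1990] Prop. 1.2∕8, [Artin1986NeronModels] Cor. (1.4); ★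
`AbelianSchemeOver.existsUnique_hom_map_genericFibre_eq'`, `isMonHom_of_isMonHom_genericFibre`) `g_K` extends to a homomorphism `ψ : B → A`, and
`φ ψ = [n]_A`, `ψ φ = [n]_B` over `R` by the UNIQUENESS of extensions (★ `map_id_pow'`, ★ `AbelianVariety.hom_zsmul_id`).  (3) EVERY FIBRE: at any
field point `t : Spec Ω → Spec R`, `φ_t ψ_t = [n]` (★ `fibreHom_comp`) and `dim A_t = dim B_t` (relative dimensions are constant over the connected
`Spec R`, ★ `exists_isOfRelDim` + ★ `dim_fibre_of_isOfRelDim`, and equal at the generic point, ★ `dim_eq_of_isIsogeny`), so `φ_t` is an isogeny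
(★ `isIsogeny_of_comp_eq_nsmul_id_of_dim_eq`, [GortzWedhorn2023] Cor. 27.177 (2)).  (4) Hence ([GortzWedhorn2023] Cor. 27.177 (1), ★
`AbelianSchemeOverIsogenyFinite`) `φ` is finite (and flat, surjective) and `Ker φ → Spec R` is finite and flat — «`Ker φ` is the schematic closure
of `Ker φ_K`» in the only form a flat closed subscheme over a DVR can take.

* **`exists_quasiInverse_of_isIsogeny_genericFibre`** — `∃ ψ (IsMonHom ψ) n, 0 < n ∧ φ ≫ ψ = (𝟙 A.X) ^ n ∧ ψ ≫ φ = (𝟙 B.X) ^ n`;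
* **`isIsogeny_fibreHom_of_isIsogeny_genericFibre`** — `IsIsogeny (fibreHom φ t)` for EVERY field point `t` (the special fibre, every geometric fibre);
* `isFinite_left_of_isIsogeny_genericFibre`, `isFinite_fst_unit_of_isIsogeny_genericFibre`, `flat_fst_unit_of_isIsogeny_genericFibre` — BY NAME over ★.

## References
* [BoschLutkebohmertRaynaud1990] S. Bosch, W. Lütkebohmert, M. Raynaud, *Néron Models* (1990), §1.2 Prop. 8 (abelian schemes are Néron models), §7.3
  Prop. 6 (isogenies and Néron models).
* [GortzWedhorn2023] U. Görtz, T. Wedhorn, *Algebraic Geometry II* (2023), Def. 27.176, Cor. 27.177 (1)–(2), Prop. 27.190.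
* [MumfordAV1970] D. Mumford, *Abelian Varieties* (1970), §19 Remark p. 169 (quasi-inverse of an isogeny), §7 Thm. 4.
* [Artin1986NeronModels] M. Artin, *Néron models*, in: Arithmetic Geometry (Cornell–Silverman, 1986), §1 (1.1), Cor. (1.4).
-/

set_option autoImplicit false

noncomputable section

universe u

open CategoryTheory CategoryTheory.Limits AlgebraicGeometry MonoidalCategory CartesianMonoidalCategory
open scoped MonObj CategoryTheory.Obj
open Literature.NumberTheory.EllipticCurves (genericFibre specGenericPoint)
open Literature.AlgebraicGeometry.Motives (AbelianVariety)

namespace Literature.AlgebraicGeometry.AbelianSchemes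

namespace AbelianSchemeOver

variable {R : Type u} [CommRing R] [IsDedekindDomain R] (K : Type u) [Field K] [Algebra R K] [IsFractionRing R K]
  {A B : AbelianSchemeOver (Spec (CommRingCat.of R))} (φ : A.X ⟶ B.X) [IsMonHom φ]

omit [IsDedekindDomain R] [IsFractionRing R K] in
/-- The generic fibre of `[n]_A = (𝟙 A.X) ^ n` is `n • 𝟙 (A_K)` (★ `map_id_pow'`, ★ `AbelianVariety.hom_zsmul_id`).
[cite: GortzWedhorn2023, Def. 27.176] -/
theorem map_genericFibre_id_pow (A : AbelianSchemeOver (Spec (CommRingCat.of R))) (n : ℕ) :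
    (genericFibre R K).map ((𝟙 A.X : A.X ⟶ A.X) ^ n) =
      ((n • 𝟙 (A.fibre (specGenericPoint R K)).toAbelianVariety :
        (A.fibre (specGenericPoint R K)).toAbelianVariety ⟶ (A.fibre (specGenericPoint R K)).toAbelianVariety)).hom.hom.hom := by
  rw [← natCast_zsmul, AbelianVariety.hom_zsmul_id, zpow_natCast, map_id_pow']
  rfl

/-- **QUASI-INVERSE OVER `R`.**  If the generic fibre of `φ : A → B` (abelian schemes over a Dedekind domain `R`) is an isogeny, there are a
homomorphism `ψ : B → A` and `n ≥ 1` with `φ ψ = [n]_A` and `ψ φ = [n]_B` OVER `R`: the quasi-inverse of `φ_K` ([MumfordAV1970] §19 Remark p. 169, ★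
`IsIsogeny.exists_nsmul_inverse_holds`) extends by the Néron mapping property (★ `existsUnique_hom_map_genericFibre_eq'`), and the two identities
hold over `R` because they hold on the generic fibres (uniqueness of extensions). [cite: BoschLutkebohmertRaynaud1990, §1.2 Prop. 8 and §7.3 Prop. 6]
[cite: MumfordAV1970, §19 Remark p. 169] [cite: Artin1986NeronModels, §1 (1.1) and Cor. (1.4)] -/
theorem exists_quasiInverse_of_isIsogeny_genericFibre
    (hφ : AbelianVariety.IsIsogeny (fibreHom φ (specGenericPoint R K))) :
    ∃ (ψ : B.X ⟶ A.X) (_ : IsMonHom ψ) (n : ℕ), 0 < n ∧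
      φ ≫ ψ = (𝟙 A.X : A.X ⟶ A.X) ^ n ∧ ψ ≫ φ = (𝟙 B.X : B.X ⟶ B.X) ^ n := by
  obtain ⟨gK, n, hn, h1, h2⟩ := AbelianVariety.IsIsogeny.exists_nsmul_inverse_holds hφ
  -- extend the quasi-inverse over `R`
  obtain ⟨ψ, hψ, -⟩ := B.existsUnique_hom_map_genericFibre_eq' K A gK.hom.hom.hom
  haveI : IsMonHom ((genericFibre R K).map ψ) := by rw [hψ]; exact gK.hom.hom.isMonHom_hom
  haveI : IsMonHom ψ := AbelianSchemeOver.isMonHom_of_isMonHom_genericFibre K B A ψ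
  refine ⟨ψ, inferInstance, n, hn, ?_, ?_⟩
  · obtain ⟨f, -, huniq⟩ := A.existsUnique_hom_map_genericFibre_eq' K A
      ((n • 𝟙 (A.fibre (specGenericPoint R K)).toAbelianVariety :
        (A.fibre (specGenericPoint R K)).toAbelianVariety ⟶ (A.fibre (specGenericPoint R K)).toAbelianVariety)).hom.hom.hom
    have e1 : (genericFibre R K).map (φ ≫ ψ) =
        ((n • 𝟙 (A.fibre (specGenericPoint R K)).toAbelianVariety :
          (A.fibre (specGenericPoint R K)).toAbelianVariety ⟶ (A.fibre (specGenericPoint R K)).toAbelianVariety)).hom.hom.hom := by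
      rw [Functor.map_comp, hψ, ← h1]
      rfl
    exact (huniq _ e1).trans (huniq _ (map_genericFibre_id_pow K A n)).symm
  · obtain ⟨f, -, huniq⟩ := B.existsUnique_hom_map_genericFibre_eq' K B
      ((n • 𝟙 (B.fibre (specGenericPoint R K)).toAbelianVariety :
        (B.fibre (specGenericPoint R K)).toAbelianVariety ⟶ (B.fibre (specGenericPoint R K)).toAbelianVariety)).hom.hom.hom
    have e2 : (genericFibre R K).map (ψ ≫ φ) =
        ((n • 𝟙 (B.fibre (specGenericPoint R K)).toAbelianVariety :
          (B.fibre (specGenericPoint R K)).toAbelianVariety ⟶ (B.fibre (specGenericPoint R K)).toAbelianVariety)).hom.hom.hom := by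
      rw [Functor.map_comp, hψ, ← h2]
      rfl
    exact (huniq _ e2).trans (huniq _ (map_genericFibre_id_pow K B n)).symm

/-- **A GENERIC ISOGENY IS AN ISOGENY ON EVERY FIBRE.**  `R` a Dedekind domain with fraction field `K`, `φ : A → B` a homomorphism of abelian schemes
over `Spec R` whose generic fibre `φ_K` is an isogeny; then for EVERY field point `t : Spec Ω → Spec R` (the special fibre of a DVR, every geometric
point) the fibre `φ_t : A_t → B_t` is an isogeny: `φ_t ψ_t = [n]` for the quasi-inverse over `R`, and `dim A_t = dim B_t` (constant relative dimensions
over the connected `Spec R`, equal at the generic point). [cite: BoschLutkebohmertRaynaud1990, §7.3 Prop. 6 (p. 180)] [cite: GortzWedhorn2023, Cor. 27.177 (2)]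
[cite: MumfordAV1970, §19 Remark p. 169] -/
theorem isIsogeny_fibreHom_of_isIsogeny_genericFibre
    (hφ : AbelianVariety.IsIsogeny (fibreHom φ (specGenericPoint R K))) {Ω : Type u} [Field Ω]
    (t : Spec (CommRingCat.of Ω) ⟶ Spec (CommRingCat.of R)) : AbelianVariety.IsIsogeny (fibreHom φ t) := by
  obtain ⟨ψ, _, n, hn, h1, -⟩ := exists_quasiInverse_of_isIsogeny_genericFibre K φ hφ
  -- equal dimensions on every fibre
  haveI : ConnectedSpace ↥(Spec (CommRingCat.of R)) := inferInstance
  obtain ⟨g, hA⟩ := A.exists_isOfRelDim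
  obtain ⟨g', hB⟩ := B.exists_isOfRelDim
  have hgg' : g = g' := by
    have h := AbelianVariety.dim_eq_of_isIsogeny hφ
    rwa [dim_fibre_of_isOfRelDim hA, dim_fibre_of_isOfRelDim hB] at h
  have hdim : (A.fibre t).toAbelianVariety.dim = (B.fibre t).toAbelianVariety.dim := by
    rw [dim_fibre_of_isOfRelDim hA, dim_fibre_of_isOfRelDim hB, hgg']
  -- `φ_t ψ_t = [n]`
  have hcomp : fibreHom φ t ≫ fibreHom ψ t = n • 𝟙 (A.fibre t).toAbelianVariety := by
    rw [← fibreHom_comp]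
    apply AbelianVariety.hom_ext
    rw [fibreHom_hom_hom_hom, h1, map_id_pow', ← natCast_zsmul, AbelianVariety.hom_zsmul_id, zpow_natCast]
    rfl
  exact (AbelianVariety.isIsogeny_of_comp_eq_nsmul_id_of_dim_eq (Nat.pos_iff_ne_zero.mp hn) hcomp hdim).1

/-! ### Consequences BY NAME over ★ `AbelianSchemeOverIsogenyFinite` ([GortzWedhorn2023] Cor. 27.177 (1)) -/

/-- **A generic isogeny is FINITE** (hence, with ★ `flat_left_of_isIsogeny_fibreHom` ∕ `surjective_left_…`, finite locally free and surjective).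
[cite: GortzWedhorn2023, Cor. 27.177 (1)] [cite: BoschLutkebohmertRaynaud1990, §7.3 Prop. 6 (p. 180)] -/
theorem isFinite_left_of_isIsogeny_genericFibre (hφ : AbelianVariety.IsIsogeny (fibreHom φ (specGenericPoint R K))) :
    IsFinite φ.left :=
  isFinite_left_of_isIsogeny_fibreHom φ fun _ _ _ t => isIsogeny_fibreHom_of_isIsogeny_genericFibre K φ hφ t

/-- **The kernel of a generic isogeny is FINITE over `Spec R`** (`Ker φ = Spec R ×_{e, B, φ} A`). [cite: GortzWedhorn2023, Cor. 27.177 (1)]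
[cite: BoschLutkebohmertRaynaud1990, §7.3 Prop. 6 (p. 180)] -/
theorem isFinite_fst_unit_of_isIsogeny_genericFibre (hφ : AbelianVariety.IsIsogeny (fibreHom φ (specGenericPoint R K))) :
    IsFinite (pullback.fst (η[B.X] : 𝟙_ (Over (Spec (CommRingCat.of R))) ⟶ B.X).left φ.left) :=
  isFinite_fst_unit_of_isIsogeny_fibreHom φ fun _ _ _ t => isIsogeny_fibreHom_of_isIsogeny_genericFibre K φ hφ t

/-- **The kernel of a generic isogeny is FLAT over `Spec R`** — so `Ker φ` is a finite flat (= locally free) closed subgroup scheme of `A` with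
generic fibre `Ker φ_K`, i.e. the schematic closure of `Ker φ_K` in `A`, and its special fibre is `Ker φ_κ`. [cite: GortzWedhorn2023, Cor. 27.177 (1)]
[cite: BoschLutkebohmertRaynaud1990, §7.3 Prop. 6 (p. 180)] -/
theorem flat_fst_unit_of_isIsogeny_genericFibre (hφ : AbelianVariety.IsIsogeny (fibreHom φ (specGenericPoint R K))) :
    Flat (pullback.fst (η[B.X] : 𝟙_ (Over (Spec (CommRingCat.of R))) ⟶ B.X).left φ.left) :=
  flat_fst_unit_of_isIsogeny_fibreHom φ fun _ _ _ t => isIsogeny_fibreHom_of_isIsogeny_genericFibre K φ hφ t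

end AbelianSchemeOver

end Literature.AlgebraicGeometry.AbelianSchemes

end
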